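import Summits.QuantumFields.YangMills.Theorems.IR.HeavyTwistNoEater
import Literature.MathematicalPhysics.QuantumFieldTheory.WilsonFinTorusPartitionSymmetry
import Literature.MathematicalPhysics.QuantumLattice.QuaternionSpinGaugeGroup
import HarnessLib

/-!
# Crux `IR` (stmt-QuantumFields-19354), line `heavy-twist` — the OTHER half of the dichotomy:
# a twist-eater forbids exponential decay; commutator pairs are eaters; `SU(2)`'s quaternion pair eats `−1`

Helper module for item `stmt-QuantumFields-19354` (`--supports … --as helper`; closes nothing, touches no registered stub).
Companion of `Theorems/IR/HeavyTwistNoEater.lean` (no twist-eater ⇒ `HeavyTwistAt` with EXPONENTIAL rate; abelian groups have no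
eater).  Here the converse side, in the same cold-box currency of line `heavy-twist` (`twistFactor`, `twistedColdZ`, `twistRatio`):

* §1 **`twistRatio_ge_of_zero`** / **`tendsto_exp_mul_twistRatio_atTop_of_zero`** (every compact `G`): if the `c`-twisted Wilson
  action of the cold box `L³×⌊L/4⌋` HAS a zero (a twist-eater), then for every `s > 0` there is `v > 0` with `v e^{−βs} ≤ r_β(L)`
  (`β ≥ 0`) — `Z^{(c)} ≥ e^{−βs}·Haar{A_c < s}` (open set containing the eater), `Z ≤ 1` — hence `e^{κβ} r_β(L) → ∞` for every
  `κ > 0`: the twist ratio is NOT exponentially small.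
* §2 **`exists_twistAction_eq_zero_of_commutator`** (every group `G`, every representation, every box): if
  `c · (g_x g_a g_x⁻¹ g_a⁻¹) = 1` then the LADDER configuration (`g_x` on the `0`-links of the slice `x₀ = 0`, `g_a` on the `3`-links of
  the slice `x₃ = 0`, `1` elsewhere) is a zero of the `c`-twisted action (twist `update 1 0 c` in the `(0,3)`-planes): all untwisted
  plaquettes are trivial, the `(0,3)`-plaquettes at `x₀ = x₃ = 0` are the commutator, cancelled by the twist factor.
* §3 `SU(2)`: **`minusOneSU2_mul_commutator_q8`** — the spin-½ images of the generators of the quaternion group `Q₈`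
  (`Literature/…/QuaternionSpinGaugeGroup.lean`: `x a x⁻¹ = a⁻¹`, `ρ(a)² = −1`) satisfy `(−1)·(q_x q_a q_x⁻¹ q_a⁻¹) = 1`; hence
  **`exists_twistEater_su2`** (every `Fin` box), **`tendsto_exp_mul_twistRatio_su2`** (`e^{κβ}·r_β(L) → ∞`, every `L`, `κ > 0`) and
  **`not_exponential_twistRatio_su2`** (no bound `r_β(L) ≤ C e^{−κβ}` eventually).

READING.  Together with the companion file this is the precise DICHOTOMY behind the critics' pricing of S2 `HeavyTwistSU2`
(ym-ir-crit-3 06:27Z «twist-eaters EXIST for this stack (min S^{tw} = 0, so no cheap exponential bound)», crit-1 06:54Z): no eater ⇒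
exponential heaviness (U(1)₄); eater ⇒ at best sub-exponential decay (SU(2): the TRUE statement S2 is a power law `β^{−3/2}` mod log,
a Laplace/Hessian computation this file does NOT do).  Cubic-torus sibling in the tree (different currency, symmetric `L^d`, all six
planes twistable): `Literature/MathematicalPhysics/QuantumLattice/TwistedSectorClassicalRate.lean` (Laplace principle, eater
classification, 't Hooft's non-orthogonal twist).

HONEST FRAMING.  Calibration ∕ negative-side knowledge about the line's own stub; S2 is NOT proved or refuted here (it asserts
`r_β → 0`, compatible with sub-exponential decay); nothing bears on `BalabanLadder.IR` (0/1), `IRcof`, confinement, a lattice gap or the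
Yang–Mills mass gap (Clay), which are NOT proved; `R4` closes only `BalabanLadder.UV`; width toward IR: 0.
References: G. 't Hooft, Nucl. Phys. B 153 (1979) 141, §4 (twist-eating configurations); A. González-Arroyo, hep-th/9807108, §4.2, §8.1
(twist eaters, zero-action configurations); card `Cruxes/IR/Lines/heavy-twist.md`.
-/

set_option autoImplicit false

noncomputable section

open Filter Topology MeasureTheory
open Literature.MathematicalPhysics.QuantumFieldTheory Literature.MathematicalPhysics.QuantumLattice
open Summit.QuantumFields.YangMills.Theorems.ColdExitSC.Negative.HeavyTwist
open Summit.QuantumFields.YangMills.Cruxes.IR.HeavyTwistNoEater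
open scoped Matrix

namespace Summit.QuantumFields.YangMills.Cruxes.IR.HeavyTwistEater

/-! ## §1 A zero of the twisted action (a twist-eater) forbids exponential decay of the twist ratio -/

section Lower

variable {G : Type} [Group G] [TopologicalSpace G] [IsTopologicalGroup G] [CompactSpace G]
  [MeasurableSpace G] [BorelSpace G] [SecondCountableTopology G]
variable {N : ℕ} (ρ : G →* Matrix (Fin N) (Fin N) ℂ)

/-- **Lower bound from a sub-level set, twisted:** for `β ≥ 0`, `Z^{(z)}_β(L³×t) ≥ e^{−βs} · Haar{U : A_z(U) < s}`. -/
theorem exp_mul_measure_le_twistedColdZ (hρ : Continuous ρ) {β : ℝ} (hβ : 0 ≤ β) (z : Fin 4 → G) {L t : ℕ} (s : ℝ) :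
    Real.exp (-(β * s)) *
        ((Measure.pi fun _ : FinTorusSite L L L t × Fin 4 => haarProbability G)
          {U | ∑ x : FinTorusSite L L L t, ∑ q : {q : Fin 4 × Fin 4 // q.1 < q.2},
            ((N : ℝ) - (ρ (twistFactor z x q.1.1 q.1.2 * finTorusPlaquette U x q.1.1 q.1.2)).trace.re) < s}).toReal ≤
      twistedColdZ ρ β z L t := by
  rw [twistedColdZ_eq_integral]
  set μ : Measure (FinTorusSite L L L t × Fin 4 → G) := Measure.pi fun _ => haarProbability G with hμ
  haveI : IsProbabilityMeasure μ := by rw [hμ]; infer_instance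
  set A : (FinTorusSite L L L t × Fin 4 → G) → ℝ := fun U =>
    ∑ x : FinTorusSite L L L t, ∑ q : {q : Fin 4 × Fin 4 // q.1 < q.2},
      ((N : ℝ) - (ρ (twistFactor z x q.1.1 q.1.2 * finTorusPlaquette U x q.1.1 q.1.2)).trace.re) with hA
  have hc : Continuous A := continuous_twistAction ρ hρ z
  have hS : MeasurableSet {U | A U < s} := (isOpen_lt hc continuous_const).measurableSet
  have hind : ∀ U, Real.exp (-(β * s)) * Set.indicator {U | A U < s} (fun _ => (1 : ℝ)) U ≤ Real.exp (-β * A U) := by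
    intro U
    by_cases hU : U ∈ {U | A U < s}
    · rw [Set.indicator_of_mem hU, mul_one]
      exact Real.exp_le_exp.2 (by have := hU; simp only [Set.mem_setOf_eq] at this; nlinarith)
    · rw [Set.indicator_of_notMem hU, mul_zero]
      exact (Real.exp_pos _).le
  calc Real.exp (-(β * s)) * (μ {U | A U < s}).toReal
      = ∫ U, Real.exp (-(β * s)) * Set.indicator {U | A U < s} (fun _ => (1 : ℝ)) U ∂μ := by
        rw [integral_const_mul, integral_indicator_const _ hS, smul_eq_mul, mul_one, Measure.real]
    _ ≤ ∫ U, Real.exp (-β * A U) ∂μ := by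
        refine integral_mono ?_ ((Real.continuous_exp.comp (continuous_const.mul hc)).integrable_of_hasCompactSupport
          (IsCompact.of_isClosed_subset isCompact_univ (isClosed_tsupport _) (Set.subset_univ _))) hind
        exact (integrable_const _).indicator hS |>.const_mul _
    _ = _ := by rfl

omit [SecondCountableTopology G] in
/-- A sub-level set `{A_z < s}`, `s > 0`, containing a ZERO of the twisted action has positive Haar measure. -/
theorem measure_twistActionBelow_pos_of_zero (hρ : Continuous ρ) (z : Fin 4 → G) {L t : ℕ}
    {U₀ : FinTorusSite L L L t × Fin 4 → G}
    (hU₀ : ∑ x : FinTorusSite L L L t, ∑ q : {q : Fin 4 × Fin 4 // q.1 < q.2},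
      ((N : ℝ) - (ρ (twistFactor z x q.1.1 q.1.2 * finTorusPlaquette U₀ x q.1.1 q.1.2)).trace.re) = 0)
    {s : ℝ} (hs : 0 < s) :
    0 < ((Measure.pi fun _ : FinTorusSite L L L t × Fin 4 => haarProbability G)
          {U | ∑ x : FinTorusSite L L L t, ∑ q : {q : Fin 4 × Fin 4 // q.1 < q.2},
            ((N : ℝ) - (ρ (twistFactor z x q.1.1 q.1.2 * finTorusPlaquette U x q.1.1 q.1.2)).trace.re) < s}).toReal := by
  haveI : (haarProbability G).IsOpenPosMeasure := by
    dsimp [haarProbability]; infer_instance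
  haveI : IsProbabilityMeasure (haarProbability G) := inferInstance
  set A : (FinTorusSite L L L t × Fin 4 → G) → ℝ := fun U =>
    ∑ x : FinTorusSite L L L t, ∑ q : {q : Fin 4 × Fin 4 // q.1 < q.2},
      ((N : ℝ) - (ρ (twistFactor z x q.1.1 q.1.2 * finTorusPlaquette U x q.1.1 q.1.2)).trace.re) with hA
  have hc : Continuous A := continuous_twistAction ρ hρ z
  have hopen : IsOpen {U | A U < s} := isOpen_lt hc continuous_const
  have hmem : U₀ ∈ {U | A U < s} := by
    simp only [Set.mem_setOf_eq]
    have : A U₀ = 0 := hU₀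
    linarith
  exact ENNReal.toReal_pos (hopen.measure_pos _ ⟨_, hmem⟩).ne' (measure_lt_top _ _).ne

/-- **A twist-eater forbids exponential decay.**  If the `c`-twisted action of the cold box `L³×⌊L/4⌋` has a zero, then for
every `s > 0` there is `v > 0` with `v · e^{−βs} ≤ r_β(L)` for all `β ≥ 0` (`Z^{(c)} ≥ e^{−βs}·Haar{A_c < s}`, `Z ≤ 1`). -/
theorem twistRatio_ge_of_zero (r : LatticeRep G) (c : G) (μ : Fin 4) {L : ℕ}
    (h0 : ∃ U₀ : FinTorusSite L L L (L / 4) × Fin 4 → G,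
      ∑ x : FinTorusSite L L L (L / 4), ∑ q : {q : Fin 4 × Fin 4 // q.1 < q.2},
        ((r.N : ℝ) - (r.ρ (twistFactor (Function.update 1 μ c) x q.1.1 q.1.2 *
          finTorusPlaquette U₀ x q.1.1 q.1.2)).trace.re) = 0)
    {s : ℝ} (hs : 0 < s) :
    ∃ v : ℝ, 0 < v ∧ ∀ β : ℝ, 0 ≤ β → v * Real.exp (-(β * s)) ≤ twistRatio r c μ β L := by
  obtain ⟨U₀, hU₀⟩ := h0
  refine ⟨_, measure_twistActionBelow_pos_of_zero r.ρ r.continuous (Function.update 1 μ c) hU₀ hs, fun β hβ => ?_⟩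
  have hZ1 : wilsonFinTorusPartition r.ρ β L L L (L / 4) ≤ 1 :=
    wilsonFinTorusPartition_le_one_of_nonneg r.ρ r.continuous hβ L L L (L / 4)
  have hZpos : 0 < wilsonFinTorusPartition r.ρ β L L L (L / 4) := wilsonFinTorusPartition_pos r.continuous β L L L (L / 4)
  have hnum := exp_mul_measure_le_twistedColdZ r.ρ r.continuous hβ (Function.update 1 μ c) (L := L) (t := L / 4) s
  unfold twistRatio
  have hT0 : 0 ≤ twistedColdZ r.ρ β (Function.update 1 μ c) L (L / 4) := by
    rw [twistedColdZ_eq_integral]; exact integral_nonneg fun U => (Real.exp_pos _).le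
  calc _ = Real.exp (-(β * s)) * _ := mul_comm _ _
    _ ≤ twistedColdZ r.ρ β (Function.update 1 μ c) L (L / 4) := hnum
    _ ≤ _ := le_div_self hT0 hZpos hZ1

/-- Hence, with a twist-eater, `e^{κβ} · r_β(L) → ∞` for EVERY `κ > 0`: the twist ratio is not exponentially small — the
no-eater criterion `heavyTwistAt_of_noEater` (exponential decay) is void exactly when eaters exist. -/
theorem tendsto_exp_mul_twistRatio_atTop_of_zero (r : LatticeRep G) (c : G) (μ : Fin 4) {L : ℕ}
    (h0 : ∃ U₀ : FinTorusSite L L L (L / 4) × Fin 4 → G,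
      ∑ x : FinTorusSite L L L (L / 4), ∑ q : {q : Fin 4 × Fin 4 // q.1 < q.2},
        ((r.N : ℝ) - (r.ρ (twistFactor (Function.update 1 μ c) x q.1.1 q.1.2 *
          finTorusPlaquette U₀ x q.1.1 q.1.2)).trace.re) = 0)
    {κ : ℝ} (hκ : 0 < κ) :
    Tendsto (fun β : ℝ => Real.exp (κ * β) * twistRatio r c μ β L) atTop atTop := by
  obtain ⟨v, hv, hle⟩ := twistRatio_ge_of_zero r c μ h0 (half_pos hκ)
  have hlow : Tendsto (fun β : ℝ => v * Real.exp (κ / 2 * β)) atTop atTop :=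
    (Real.tendsto_exp_atTop.comp (tendsto_id.const_mul_atTop (half_pos hκ))).const_mul_atTop hv
  refine tendsto_atTop_mono' atTop ?_ hlow
  filter_upwards [eventually_ge_atTop (0 : ℝ)] with β hβ
  have h := hle β hβ
  have hexp : Real.exp (κ * β) = Real.exp (κ / 2 * β) * Real.exp (β * (κ / 2)) := by
    rw [← Real.exp_add]; ring_nf
  calc v * Real.exp (κ / 2 * β) = Real.exp (κ / 2 * β) * (v * Real.exp (-(β * (κ / 2)))) * Real.exp (β * (κ / 2)) := by
        rw [Real.exp_neg]; field_simp
    _ ≤ Real.exp (κ / 2 * β) * twistRatio r c μ β L * Real.exp (β * (κ / 2)) := by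
        gcongr
    _ = Real.exp (κ * β) * twistRatio r c μ β L := by rw [hexp]; ring

end Lower


/-! ## §2 A commutator pair eating `c` gives a twist-eater on every cold box (every group `G`) -/

section Eater

variable {G : Type} [Group G]

/-- Shifting a site in a direction `≠ 0` does not change its `0`-th coordinate. -/
theorem shift_fst_of_ne {n₀ n₁ n₂ n₃ : ℕ} (y : FinTorusSite n₀ n₁ n₂ n₃) {μ : Fin 4} (hμ : μ ≠ 0) :
    (y.shift μ).1 = y.1 := by
  fin_cases μ
  · exact absurd rfl hμ
  · simp [FinTorusSite.shift]
  · simp [FinTorusSite.shift]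
  · simp [FinTorusSite.shift]

/-- Shifting a site in a direction `≠ 3` does not change its `3`-rd coordinate. -/
theorem shift_last_of_ne {n₀ n₁ n₂ n₃ : ℕ} (y : FinTorusSite n₀ n₁ n₂ n₃) {μ : Fin 4} (hμ : μ ≠ 3) :
    (y.shift μ).2.2.2 = y.2.2.2 := by
  fin_cases μ
  · simp [FinTorusSite.shift]
  · simp [FinTorusSite.shift]
  · simp [FinTorusSite.shift]
  · exact absurd rfl hμ

/-- The `(0,3)` twist factor of the single temporal twist `update 1 0 c`: `c` exactly at `x₀ = x₃ = 0`. -/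
theorem twistFactor_update_zero_03 (c : G) {n₀ n₁ n₂ n₃ : ℕ} (y : FinTorusSite n₀ n₁ n₂ n₃) :
    twistFactor (Function.update 1 0 c) y 0 3 = if (y.2.2.2 : ℕ) = 0 ∧ (y.1 : ℕ) = 0 then c else 1 := by
  unfold twistFactor siteCoord
  have h3 : (![(y.1 : ℕ), (y.2.1 : ℕ), (y.2.2.1 : ℕ), (y.2.2.2 : ℕ)] : Fin 4 → ℕ) 3 = (y.2.2.2 : ℕ) := rfl
  have h0 : (![(y.1 : ℕ), (y.2.1 : ℕ), (y.2.2.1 : ℕ), (y.2.2.2 : ℕ)] : Fin 4 → ℕ) 0 = (y.1 : ℕ) := rfl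
  simp only [h3, h0, Function.update_self, true_and]

/-- The `(μ, ν)` twist factor of `update 1 0 c` is trivial unless `(μ, ν) = (0, 3)`. -/
theorem twistFactor_update_zero_of_ne (c : G) {n₀ n₁ n₂ n₃ : ℕ} (y : FinTorusSite n₀ n₁ n₂ n₃) {μ ν : Fin 4}
    (h : μ ≠ 0 ∨ ν ≠ 3) : twistFactor (Function.update 1 0 c) y μ ν = 1 := by
  unfold twistFactor
  rcases h with hμ | hν
  · simp only [Function.update_of_ne hμ, Pi.one_apply, ite_self]
  · simp only [hν, false_and, if_false]

/-- **The ladder configuration of a commutator pair is a twist-eater.**  If `c · (g_x g_a g_x⁻¹ g_a⁻¹) = 1`, the configuration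
with `g_x` on the `0`-links of the slice `x₀ = 0`, `g_a` on the `3`-links of the slice `x₃ = 0` and `1` elsewhere has every
UNtwisted plaquette holonomy trivial and the `(0,3)`-plaquettes at `x₀ = x₃ = 0` equal to the commutator `= c⁻¹`, which the
twist factor `c` cancels: the `c`-twisted Wilson action (twist in the `(0,3)`-planes) VANISHES at it.  Every group, every
representation, every box. -/
theorem exists_twistAction_eq_zero_of_commutator {N : ℕ} (ρ : G →* Matrix (Fin N) (Fin N) ℂ) {c gx ga : G}
    (h : c * (gx * ga * gx⁻¹ * ga⁻¹) = 1) (n₀ n₁ n₂ n₃ : ℕ) :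
    ∃ U : FinTorusSite n₀ n₁ n₂ n₃ × Fin 4 → G,
      ∑ x : FinTorusSite n₀ n₁ n₂ n₃, ∑ q : {q : Fin 4 × Fin 4 // q.1 < q.2},
        ((N : ℝ) - (ρ (twistFactor (Function.update 1 0 c) x q.1.1 q.1.2 * finTorusPlaquette U x q.1.1 q.1.2)).trace.re) = 0 := by
  classical
  -- the ladder configuration, by direction
  let link0 : FinTorusSite n₀ n₁ n₂ n₃ → G := fun y => if (y.1 : ℕ) = 0 then gx else 1
  let link3 : FinTorusSite n₀ n₁ n₂ n₃ → G := fun y => if (y.2.2.2 : ℕ) = 0 then ga else 1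
  let U : FinTorusSite n₀ n₁ n₂ n₃ × Fin 4 → G := fun p => ![link0 p.1, 1, 1, link3 p.1] p.2
  have hU0 : ∀ y, U (y, 0) = link0 y := fun y => rfl
  have hU1 : ∀ y, U (y, 1) = 1 := fun y => rfl
  have hU2 : ∀ y, U (y, 2) = 1 := fun y => rfl
  have hU3 : ∀ y, U (y, 3) = link3 y := fun y => rfl
  have hl0 : ∀ y (μ : Fin 4), μ ≠ 0 → link0 (y.shift μ) = link0 y := fun y μ hμ => by
    simp only [link0, shift_fst_of_ne y hμ]
  have hl3 : ∀ y (μ : Fin 4), μ ≠ 3 → link3 (y.shift μ) = link3 y := fun y μ hμ => by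
    simp only [link3, shift_last_of_ne y hμ]
  refine ⟨U, Finset.sum_eq_zero fun x _ => Finset.sum_eq_zero fun q _ => ?_⟩
  -- it suffices that every twisted holonomy is trivial
  suffices hq : twistFactor (Function.update 1 0 c) x q.1.1 q.1.2 * finTorusPlaquette U x q.1.1 q.1.2 = 1 by
    rw [hq, map_one, Matrix.trace_one, Fintype.card_fin, Complex.natCast_re, sub_self]
  obtain ⟨⟨μ, ν⟩, hμν⟩ := q
  -- the corner planes `(0,3)`
  have h03 : twistFactor (Function.update 1 0 c) x 0 3 * finTorusPlaquette U x 0 3 = 1 := by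
    rw [twistFactor_update_zero_03, finTorusPlaquette, hU0, hU3, hU0, hU3,
      hl3 x 0 (by decide), hl0 x 3 (by decide)]
    simp only [link0, link3]
    by_cases ha : (x.2.2.2 : ℕ) = 0 <;> by_cases hx : (x.1 : ℕ) = 0 <;> simp [ha, hx, h]
  -- `(0, ν)` with `ν = 1, 2`
  have h0ν : ∀ ν' : Fin 4, ν' ≠ 0 → ν' ≠ 3 → (∀ y, U (y, ν') = 1) →
      twistFactor (Function.update 1 0 c) x 0 ν' * finTorusPlaquette U x 0 ν' = 1 := by
    intro ν' hν0 hν3 hUν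
    rw [twistFactor_update_zero_of_ne c x (Or.inr hν3), one_mul, finTorusPlaquette, hUν, hUν, hU0, hU0, hl0 x ν' hν0]
    simp
  -- `(μ, 3)` with `μ = 1, 2`
  have hμ3 : ∀ μ' : Fin 4, μ' ≠ 0 → μ' ≠ 3 → (∀ y, U (y, μ') = 1) →
      twistFactor (Function.update 1 0 c) x μ' 3 * finTorusPlaquette U x μ' 3 = 1 := by
    intro μ' hμ0 hμ3' hUμ
    rw [twistFactor_update_zero_of_ne c x (Or.inl hμ0), one_mul, finTorusPlaquette, hUμ, hUμ, hU3, hU3, hl3 x μ' hμ3']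
    simp
  -- `(1, 2)`
  have h12 : twistFactor (Function.update 1 0 c) x 1 2 * finTorusPlaquette U x 1 2 = 1 := by
    rw [twistFactor_update_zero_of_ne c x (Or.inl (by decide)), one_mul, finTorusPlaquette, hU1, hU1, hU2, hU2]
    simp
  fin_cases μ <;> fin_cases ν <;> simp (config := { decide := true }) at hμν
  · exact h0ν 1 (by decide) (by decide) hU1
  · exact h0ν 2 (by decide) (by decide) hU2
  · exact h03
  · exact h12
  · exact hμ3 1 (by decide) (by decide) hU1
  · exact hμ3 2 (by decide) (by decide) hU2

end Eater

/-! ## §3 `SU(2)`: the quaternion pair eats the twist `−1` — so `HeavyTwistSU2` is a sub-exponential statement -/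

section SU2

open Literature.MathematicalPhysics.QuantumLattice.Q8 in
/-- **The quaternion pair eats `−1`:** with `q_x = ρ(x)`, `q_a = ρ(a)` the spin-½ images of the generators of `Q₈ ⊂ SU(2)`
(`x a x⁻¹ = a⁻¹`, `a² = −1`), `(−1) · (q_x q_a q_x⁻¹ q_a⁻¹) = 1` in `SU(2)`. -/
theorem minusOneSU2_mul_commutator_q8 :
    minusOneSU2 *
        ((⟨rep x, rep_mem_specialUnitaryGroup x⟩ : Matrix.specialUnitaryGroup (Fin 2) ℂ) *
          ⟨rep a, rep_mem_specialUnitaryGroup a⟩ *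
          (⟨rep x, rep_mem_specialUnitaryGroup x⟩ : Matrix.specialUnitaryGroup (Fin 2) ℂ)⁻¹ *
          (⟨rep a, rep_mem_specialUnitaryGroup a⟩ : Matrix.specialUnitaryGroup (Fin 2) ℂ)⁻¹) = 1 := by
  apply Subtype.ext
  have hrel : x * a * x⁻¹ * a⁻¹ = a * a := by decide
  have hcomm : rep x * rep a * (rep x)ᴴ * (rep a)ᴴ = -1 := by
    rw [← rep_inv, ← rep_inv, ← map_mul, ← map_mul, ← map_mul, hrel, map_mul, rep_a_x.1]
    ext i j
    fin_cases i <;> fin_cases j <;> simp [Matrix.mul_apply, Fin.sum_univ_two]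
  change (minusOneSU2 : Matrix (Fin 2) (Fin 2) ℂ) * (rep x * rep a * star (rep x) * star (rep a)) = 1
  rw [Matrix.star_eq_conjTranspose, Matrix.star_eq_conjTranspose, hcomm, coe_minusOneSU2]
  simp

/-- **`SU(2)` HAS twist-eaters on every cold box** (the quaternion ladder): the `(−1)`-twisted fundamental Wilson action vanishes at
some configuration of every `Fin` box — so the hypothesis of `heavyTwistAt_of_noEater` FAILS for `(SU(2), fundamental, −1, 0)`. -/
theorem exists_twistEater_su2 (n₀ n₁ n₂ n₃ : ℕ) :
    ∃ U : FinTorusSite n₀ n₁ n₂ n₃ × Fin 4 → Matrix.specialUnitaryGroup (Fin 2) ℂ,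
      ∑ x : FinTorusSite n₀ n₁ n₂ n₃, ∑ q : {q : Fin 4 × Fin 4 // q.1 < q.2},
        (((fundamentalLatticeRep 2).N : ℝ) - ((fundamentalLatticeRep 2).ρ
          (twistFactor (Function.update 1 0 minusOneSU2) x q.1.1 q.1.2 * finTorusPlaquette U x q.1.1 q.1.2)).trace.re) = 0 :=
  exists_twistAction_eq_zero_of_commutator (fundamentalLatticeRep 2).ρ minusOneSU2_mul_commutator_q8 n₀ n₁ n₂ n₃

/-- **Hence the `SU(2)` twist ratio is NOT exponentially small:** for every `L` and every `κ > 0`,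
`e^{κβ} · r_β(L) → ∞` (`r` = the twist ratio of S2 `HeavyTwistSU2`: fundamental `SU(2)`, twist `−1` in the `(0,3)`-planes).
The decay `r_β(L) → 0` asserted by S2 — TRUE per the critics — is therefore necessarily SUB-exponential (Laplace / power law,
`β^{−3/2}` mod log): "no cheap exponential bound" (ym-ir-crit-3) as a theorem. -/
theorem tendsto_exp_mul_twistRatio_su2 (L : ℕ) {κ : ℝ} (hκ : 0 < κ) :
    letI : MeasurableSpace (Matrix.specialUnitaryGroup (Fin 2) ℂ) := borel _
    haveI : BorelSpace (Matrix.specialUnitaryGroup (Fin 2) ℂ) := ⟨rfl⟩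
    Tendsto (fun β : ℝ => Real.exp (κ * β) * twistRatio (fundamentalLatticeRep 2) minusOneSU2 0 β L) atTop atTop := by
  letI : MeasurableSpace (Matrix.specialUnitaryGroup (Fin 2) ℂ) := borel _
  haveI : BorelSpace (Matrix.specialUnitaryGroup (Fin 2) ℂ) := ⟨rfl⟩
  haveI : SecondCountableTopology (Matrix.specialUnitaryGroup (Fin 2) ℂ) :=
    (fundamentalLatticeRep 2).secondCountableTopology
  exact tendsto_exp_mul_twistRatio_atTop_of_zero (fundamentalLatticeRep 2) minusOneSU2 0
    (exists_twistEater_su2 L L L (L / 4)) hκ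

/-- In particular no bound `r_β(L) ≤ C e^{−κβ}` (`κ > 0`) holds for all large `β`. -/
theorem not_exponential_twistRatio_su2 (L : ℕ) {κ C : ℝ} (hκ : 0 < κ) :
    letI : MeasurableSpace (Matrix.specialUnitaryGroup (Fin 2) ℂ) := borel _
    haveI : BorelSpace (Matrix.specialUnitaryGroup (Fin 2) ℂ) := ⟨rfl⟩
    ¬ ∀ᶠ β : ℝ in atTop, twistRatio (fundamentalLatticeRep 2) minusOneSU2 0 β L ≤ C * Real.exp (-(κ * β)) := by
  letI : MeasureTheory.MeasureSpace ℝ := by infer_instance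
  letI : MeasurableSpace (Matrix.specialUnitaryGroup (Fin 2) ℂ) := borel _
  haveI : BorelSpace (Matrix.specialUnitaryGroup (Fin 2) ℂ) := ⟨rfl⟩
  intro h
  have ht := tendsto_exp_mul_twistRatio_su2 L hκ
  have hbdd : ∀ᶠ β : ℝ in atTop, Real.exp (κ * β) * twistRatio (fundamentalLatticeRep 2) minusOneSU2 0 β L ≤ C := by
    filter_upwards [h] with β hβ
    calc Real.exp (κ * β) * twistRatio (fundamentalLatticeRep 2) minusOneSU2 0 β L
        ≤ Real.exp (κ * β) * (C * Real.exp (-(κ * β))) := mul_le_mul_of_nonneg_left hβ (Real.exp_pos _).le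
      _ = C := by rw [Real.exp_neg]; field_simp
  obtain ⟨β, hβ1, hβ2⟩ := (hbdd.and (ht.eventually_gt_atTop C)).exists
  exact absurd hβ1 (not_le.2 hβ2)

end SU2

end Summit.QuantumFields.YangMills.Cruxes.IR.HeavyTwistEater

end
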